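import Summits.QuantumFields.YangMills.Theorems.LuscherReductionOneSiteLevelsTrial
import Summits.QuantumFields.YangMills.Theorems.LuscherReductionOneSiteLevelsKacDefs
import Literature.Analysis.OperatorTheory.YangMillsMatrixModelQuasimodes
import HarnessLib

/-!
# Route `LuscherReduction`, item `DressedRitz` (stmt-QuantumFields-20205), line «polyakovlift» r6 — wave 2, task W2-F6 (part 1/3):
# the FLAT per-level quasimode package of a single cut-off eigenfunction at a general radius
# (helper lemmas `--supports stmt-QuantumFields-20205`; fleet seat prover ym-infvol-p2 g8 for the LEAD ym-lead-20205-polyakovlift g2, `WAVE-2-BRIEFS.md` §W2-F6)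

For an AL1 family `f : Fin (k+1) → ZM → ℝ` (smooth, colour-invariant, `L²`-orthonormal classical eigenfunctions of Lüscher's `𝔥 = −½Δ + V`,
`𝔥 f_j = E_j f_j`, `E_j = physLevel (j+1)`, uniform decay `|f_j| ≤ C_f e^{−‖x‖}`) and a FREE cut-off radius `R ≥ 1` (not pinned to `1/(8μ)` as in
`…OneSiteLevelsAbsLowerPrep.trial_estimate`), the flat trial functions `G_j = χ_R f_j` (`χ_R = radialCutoff R`) satisfy, PER LEVEL (no truncated
families needed — the exact localisation identity `𝔮(χ F) = E∫χ²F² + ½∫‖∇χ‖²F²` of `…CutoffEnergy` is read at the eigenfunction's own level):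
* `energyForm_cut_le`: `𝔮(χ_R f_j) ≤ E_j ∫(χ_R f_j)² + ½M₁C_f²I₉ · e^{−R}` (`I₉ = ∫e^{−‖y‖}`, `M₁` the gradient constant of `radialCutoff_package`);
* `integral_cut_sq_bounds`: `1 − C_f²I₉ e^{−R} ≤ ∫(χ_R f_j)² ≤ 1`;
* `abs_integral_cut_mul_cut_le`: flat overlaps `|∫ χ_R f_i · χ_{R′} f_j| ≤ C_f²I₉ (e^{−R} + e^{−R′})` for `i ≠ j` (orthogonality tail);
* `integral_pow_mul_cut_sq_le`: decay moments `∫‖y‖^m (χ_R f_j)² ≤ m!·C_f²I₉`; support radius `√2·R`; test-function / colour-invariance facts;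
* `flat_package`: the bundled `∃ A`-form from `IsEigenFamily k f` (ONE constant `A` for all radii and all levels).
Parts 2/3 (`…TransplantFormsTrial`, `…TransplantForms`) pull these back along `gnCoord μ` to the one-site transfer operator.

## WHAT THIS IS NOT
Fixed-lattice one-site (`L = 1`) semiclassical bookkeeping toward ONE stub (`stub_pscaling`) of ONE conditional crux on the femto rung R2b1;
nothing here is infinite volume, a continuum limit, a mass gap or the Clay problem.  Sorry-free, no named fact, no new definitions.
References: M. Lüscher, NPB 219 (1983) 233 [cite: Luscher1983, §2–§3]; S. Agmon, Lectures on exponential decay (1982) [cite: Agmon1982, (1.16″), Cor. 4.5];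
Reed–Simon IV [cite: ReedSimonIV1978, Thm. XIII.1–2, XIII.64].
-/

set_option autoImplicit false

noncomputable section

open MeasureTheory Filter Topology Real
open scoped Matrix ENNReal
open Literature.MathematicalPhysics.QuantumFieldTheory
open Literature.MathematicalPhysics.QuantumLattice
open Literature.Analysis.OperatorTheory.YMMatrixModel

namespace Summit.QuantumFields.YangMills.Theorems.FemtoTransferGap.TransplantForms

open Summit.QuantumFields.YangMills.Theorems.FemtoTransferGap

/-! ### §1. The flat per-level quasimode package of a single cut-off eigenfunction -/

section Flat

variable {k : ℕ} {f : Fin (k + 1) → ZM → ℝ}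

/-- The cut-off span at the coefficient vector `Pi.single j 1` is the single cut-off eigenfunction `χ_R f_j`. [folklore] -/
theorem cutSpan_single (f : Fin (k + 1) → ZM → ℝ) (R : ℝ) (j : Fin (k + 1)) :
    cutSpan f R (Pi.single j 1) = radialCutoff R * f j := by
  funext x
  simp [cutSpan_apply, Pi.single_apply]

/-- The same in the unfolded product form used by `quasimode_estimate` / `isTestFn_isGaugeInv_radialCutoff_mul_span`. [folklore] -/
theorem radialCutoff_mul_span_single (f : Fin (k + 1) → ZM → ℝ) (R : ℝ) (j : Fin (k + 1)) :
    (radialCutoff R * fun x => ∑ i, (Pi.single j 1 : Fin (k + 1) → ℝ) i * f i x) = radialCutoff R * f j :=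
  cutSpan_single f R j

/-- `χ_R f_j` is a colour-invariant `C²_c` test function (`R > 0`). [cite: ReedSimonIV1978, Thm. XIII.2] -/
theorem isTestFn_isGaugeInv_cut {R : ℝ} (hR : 0 < R) (hsmooth : ∀ j, ∀ n : ℕ∞, ContDiff ℝ n (f j))
    (hinv : ∀ j, IsGaugeInv (f j)) (j : Fin (k + 1)) :
    IsTestFn (radialCutoff R * f j) ∧ IsGaugeInv (radialCutoff R * f j) := by
  have h := isTestFn_isGaugeInv_radialCutoff_mul_span hR hsmooth hinv (Pi.single j 1)
  rwa [radialCutoff_mul_span_single] at h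

/-- Support radius: `χ_R f_j` vanishes outside `‖y‖ ≤ √2·R` (`R > 0`). [folklore] -/
theorem norm_le_of_cut_ne_zero {R : ℝ} (hR : 0 < R) (j : Fin (k + 1)) {y : ZM} (hy : (radialCutoff R * f j) y ≠ 0) :
    ‖y‖ ≤ Real.sqrt 2 * R := by
  rw [← cutSpan_single] at hy
  exact norm_le_of_cutSpan_ne_zero f hR _ hy

/-- A bound for `χ_R f_j`: `|χ_R f_j| ≤ C_f`. [folklore] -/
theorem abs_cut_le {Cf : ℝ} (hCf : ∀ j x, |f j x| ≤ Cf * Real.exp (-‖x‖)) (R : ℝ) (j : Fin (k + 1)) (x : ZM) :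
    |(radialCutoff R * f j) x| ≤ Cf := by
  have hχ := radialCutoff_mem_Icc R x
  have hC0 : 0 ≤ Cf := by
    have h := (abs_nonneg _).trans (hCf j 0)
    rwa [norm_zero, neg_zero, Real.exp_zero, mul_one] at h
  have he : Real.exp (-‖x‖) ≤ 1 := Real.exp_le_one_iff.mpr (neg_nonpos.mpr (norm_nonneg _))
  rw [Pi.mul_apply, abs_mul, abs_of_nonneg hχ.1]
  calc radialCutoff R x * |f j x| ≤ 1 * (Cf * Real.exp (-‖x‖)) := mul_le_mul hχ.2 (hCf j x) (abs_nonneg _) zero_le_one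
    _ ≤ Cf := by rw [one_mul]; exact mul_le_of_le_one_right hC0 he

/-- Pointwise decay: `(χ_R f_j)(y)² ≤ C_f² e^{−‖y‖}²`. [folklore] -/
theorem cut_sq_le {Cf : ℝ} (hCf : ∀ j x, |f j x| ≤ Cf * Real.exp (-‖x‖)) (R : ℝ) (j : Fin (k + 1)) (x : ZM) :
    (radialCutoff R * f j) x ^ 2 ≤ Cf ^ 2 * Real.exp (-‖x‖) ^ 2 := by
  have hχ := radialCutoff_mem_Icc R x
  have h1 : |(radialCutoff R * f j) x| ≤ Cf * Real.exp (-‖x‖) := by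
    rw [Pi.mul_apply, abs_mul, abs_of_nonneg hχ.1]
    calc radialCutoff R x * |f j x| ≤ 1 * |f j x| := mul_le_mul_of_nonneg_right hχ.2 (abs_nonneg _)
      _ ≤ Cf * Real.exp (-‖x‖) := by rw [one_mul]; exact hCf j x
  rw [← sq_abs, ← mul_pow]
  exact pow_le_pow_left₀ (abs_nonneg _) h1 2

/-- **Decay moments of a single cut-off eigenfunction**: `∫ ‖y‖^m (χ_R f_j)² ≤ m! · C_f² ∫e^{−‖y‖}`. [cite: Agmon1982, Cor. 4.5] -/
theorem integral_pow_mul_cut_sq_le {Cf : ℝ} (hCf : ∀ j x, |f j x| ≤ Cf * Real.exp (-‖x‖)) (R : ℝ) (j : Fin (k + 1)) (m : ℕ) :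
    ∫ y, ‖y‖ ^ m * (radialCutoff R * f j) y ^ 2 ≤ (m.factorial : ℝ) * (Cf ^ 2 * ∫ y : ZM, Real.exp (-‖y‖)) := by
  have hint : Integrable fun y : ZM => (m.factorial : ℝ) * Cf ^ 2 * Real.exp (-‖y‖) := (integrable_exp_neg_norm).const_mul _
  have hpt : ∀ y : ZM, ‖y‖ ^ m * (radialCutoff R * f j) y ^ 2 ≤ (m.factorial : ℝ) * Cf ^ 2 * Real.exp (-‖y‖) := by
    intro y
    have h1 := cut_sq_le hCf R j y
    have h2 := pow_mul_exp_neg_norm_le m y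
    calc ‖y‖ ^ m * (radialCutoff R * f j) y ^ 2 ≤ ‖y‖ ^ m * (Cf ^ 2 * Real.exp (-‖y‖) ^ 2) :=
          mul_le_mul_of_nonneg_left h1 (by positivity)
      _ = (‖y‖ ^ m * Real.exp (-‖y‖)) * Cf ^ 2 * Real.exp (-‖y‖) := by ring
      _ ≤ (m.factorial : ℝ) * Cf ^ 2 * Real.exp (-‖y‖) := by gcongr
  calc ∫ y, ‖y‖ ^ m * (radialCutoff R * f j) y ^ 2 ≤ ∫ y : ZM, (m.factorial : ℝ) * Cf ^ 2 * Real.exp (-‖y‖) :=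
        integral_mono_of_nonneg (ae_of_all _ fun y => by positivity) hint (ae_of_all _ hpt)
    _ = (m.factorial : ℝ) * (Cf ^ 2 * ∫ y : ZM, Real.exp (-‖y‖)) := by rw [integral_const_mul]; ring

/-- `∫ (χ_R f_j)² = ∫ χ_R² f_j²` (the `l2sq` of the cut-off function). [folklore] -/
theorem integral_cut_sq_eq (R : ℝ) (j : Fin (k + 1)) :
    ∫ y, (radialCutoff R * f j) y ^ 2 = ∫ y, radialCutoff R y ^ 2 * f j y ^ 2 :=
  integral_congr_ae (Eventually.of_forall fun y => by simp only [Pi.mul_apply, mul_pow])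

/-- **Energy of a single cut-off eigenfunction, read at its own level**: `𝔮(χ_R f_j) ≤ E_j ∫(χ_R f_j)² + ½M₁C_f²I₉ · e^{−R}` for `R ≥ 1`,
where `M₁` is the gradient constant of `radialCutoff_package`. [cite: Agmon1982, (1.16″), Cor. 4.5] -/
theorem energyForm_cut_le (hsmooth : ∀ j, ∀ n : ℕ∞, ContDiff ℝ n (f j))
    (heig : ∀ j, ∀ x : ZM, hApply (f j) x = physLevel ((j : ℕ) + 1) * f j x)
    {Cf : ℝ} (hCf : ∀ j x, |f j x| ≤ Cf * Real.exp (-‖x‖))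
    {M₁ : ℝ} (hM₁ : ∀ R : ℝ, 1 ≤ R → (∀ x : ZM, ‖x‖ < R → radialCutoff R x = 1) ∧ ∀ x : ZM, ‖gradient (radialCutoff R) x‖ ^ 2 ≤ M₁)
    {R : ℝ} (hR : 1 ≤ R) (j : Fin (k + 1)) :
    energyForm (radialCutoff R * f j) ≤
      physLevel ((j : ℕ) + 1) * (∫ y, (radialCutoff R * f j) y ^ 2) +
        (1 / 2 : ℝ) * (M₁ * Cf ^ 2 * ∫ y : ZM, Real.exp (-‖y‖)) * Real.exp (-R) := by
  have hR0 : 0 < R := lt_of_lt_of_le one_pos hR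
  obtain ⟨hone, hgrad⟩ := hM₁ R hR
  rw [energyForm_testFn_mul_eigenfunction hsmooth heig (isTestFn_radialCutoff hR0) j, ← integral_cut_sq_eq]
  have hD := abs_gradTail_le (hCf j) (hCf j) hgrad hone
  have hD' : ∫ x, ‖gradient (radialCutoff R) x‖ ^ 2 * f j x ^ 2 ≤ M₁ * Cf * Cf * Real.exp (-R) * ∫ x : ZM, Real.exp (-‖x‖) := by
    have e : ∫ x, ‖gradient (radialCutoff R) x‖ ^ 2 * f j x ^ 2 = ∫ x, ‖gradient (radialCutoff R) x‖ ^ 2 * (f j x * f j x) :=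
      integral_congr_ae (Eventually.of_forall fun x => by dsimp only; ring)
    rw [e]; exact (le_abs_self _).trans hD
  nlinarith [hD']

/-- **Mass of a single cut-off eigenfunction**: `1 − C_f²I₉ e^{−R} ≤ ∫(χ_R f_j)² ≤ 1` for `R ≥ 1`. [cite: Agmon1982, Cor. 4.5] -/
theorem integral_cut_sq_bounds (hsmooth : ∀ j, ∀ n : ℕ∞, ContDiff ℝ n (f j))
    (horth : ∀ i j, ∫ x, f i x * f j x = if i = j then (1 : ℝ) else 0)
    {Cf : ℝ} (hCf : ∀ j x, |f j x| ≤ Cf * Real.exp (-‖x‖)) {R : ℝ} (hR : 1 ≤ R) (j : Fin (k + 1)) :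
    1 - (Cf ^ 2 * ∫ y : ZM, Real.exp (-‖y‖)) * Real.exp (-R) ≤ ∫ y, (radialCutoff R * f j) y ^ 2 ∧
      ∫ y, (radialCutoff R * f j) y ^ 2 ≤ 1 := by
  have hR0 : 0 < R := lt_of_lt_of_le one_pos hR
  have hfc : ∀ j, Continuous (f j) := fun j => (contDiff_two_of_forall (hsmooth j)).continuous
  have hid := integral_sq_mul_mul_eq_of_orthonormal (isTestFn_radialCutoff hR0) hfc horth j j
  rw [if_pos rfl] at hid
  have e : ∫ y, (radialCutoff R * f j) y ^ 2 = ∫ x, radialCutoff R x ^ 2 * (f j x * f j x) := by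
    rw [integral_cut_sq_eq]; exact integral_congr_ae (Eventually.of_forall fun x => by dsimp only; ring)
  rw [e, hid]
  have hT := abs_tail_le (hCf j) (hCf j) (abs_one_sub_radialCutoff_sq_le R) fun x hx => radialCutoff_eq_one_of_lt hR0 hx
  have hT0 : 0 ≤ ∫ x, (1 - radialCutoff R x ^ 2) * (f j x * f j x) := integral_nonneg fun x => by
    have hχ := radialCutoff_mem_Icc R x
    have : radialCutoff R x ^ 2 ≤ 1 := by nlinarith [hχ.1, hχ.2]
    exact mul_nonneg (by linarith) (mul_self_nonneg _)
  constructor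
  · have := (le_abs_self _).trans hT
    nlinarith [this]
  · linarith

/-- **Flat overlaps of two cut-off eigenfunctions** (`i ≠ j`, radii `R, R′ ≥ 1`): `|∫ χ_R f_i · χ_{R′} f_j| ≤ C_f²I₉ (e^{−R} + e^{−R′})` — by
orthogonality the overlap is `−∫(1 − χ_Rχ_{R′}) f_i f_j`, a tail integral. [cite: Agmon1982, Cor. 4.5] [cite: ReedSimonIV1978, Thm. XIII.64] -/
theorem abs_integral_cut_mul_cut_le (hsmooth : ∀ j, ∀ n : ℕ∞, ContDiff ℝ n (f j))
    (horth : ∀ i j, ∫ x, f i x * f j x = if i = j then (1 : ℝ) else 0)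
    {Cf : ℝ} (hCf : ∀ j x, |f j x| ≤ Cf * Real.exp (-‖x‖)) {R R' : ℝ} (hR : 1 ≤ R) (hR' : 1 ≤ R')
    {i j : Fin (k + 1)} (hij : i ≠ j) :
    |∫ y, (radialCutoff R * f i) y * (radialCutoff R' * f j) y| ≤
      (Cf ^ 2 * ∫ y : ZM, Real.exp (-‖y‖)) * (Real.exp (-R) + Real.exp (-R')) := by
  have hR0 : 0 < R := lt_of_lt_of_le one_pos hR
  have hR0' : 0 < R' := lt_of_lt_of_le one_pos hR'
  have hfc : ∀ j, Continuous (f j) := fun j => (contDiff_two_of_forall (hsmooth j)).continuous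
  -- integrability
  have I1 : Integrable (fun x => f i x * f j x) := integrable_mul_of_orthonormal hfc horth i j
  have I2 : Integrable (fun x => radialCutoff R x * radialCutoff R' x * (f i x * f j x)) := by
    have hc : Continuous fun x => radialCutoff R x * radialCutoff R' x * (f i x * f j x) :=
      (((radialCutoff_contDiff R (n := 2)).continuous.mul (radialCutoff_contDiff R' (n := 2)).continuous).mul
        ((hfc i).mul (hfc j)))
    refine hc.integrable_of_hasCompactSupport ?_
    exact ((radialCutoff_hasCompactSupport hR0).mul_right).mul_right
  -- the orthogonality identity
  have e : ∫ y, (radialCutoff R * f i) y * (radialCutoff R' * f j) y =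
      -(∫ x, (1 - radialCutoff R x * radialCutoff R' x) * (f i x * f j x)) := by
    have e1 : ∫ y, (radialCutoff R * f i) y * (radialCutoff R' * f j) y = ∫ x, radialCutoff R x * radialCutoff R' x * (f i x * f j x) :=
      integral_congr_ae (Eventually.of_forall fun x => by simp only [Pi.mul_apply]; ring)
    have e2 : ∫ x, (1 - radialCutoff R x * radialCutoff R' x) * (f i x * f j x) =
        (∫ x, f i x * f j x) - ∫ x, radialCutoff R x * radialCutoff R' x * (f i x * f j x) := by
      rw [← integral_sub I1 I2]
      exact integral_congr_ae (Eventually.of_forall fun x => by ring)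
    rw [e1, e2, horth i j, if_neg hij]; ring
  rw [e, abs_neg]
  -- the tail bound with the weight `1 − χ_R χ_{R'}`, vanishing on the ball of radius `min R R'`
  have hM : ∀ x, |1 - radialCutoff R x * radialCutoff R' x| ≤ 1 := fun x => by
    have h1 := radialCutoff_mem_Icc R x
    have h2 := radialCutoff_mem_Icc R' x
    rw [abs_le]; constructor <;> nlinarith [h1.1, h1.2, h2.1, h2.2, mul_nonneg h1.1 h2.1]
  have hzero : ∀ x : ZM, ‖x‖ < min R R' → 1 - radialCutoff R x * radialCutoff R' x = 0 := fun x hx => by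
    rw [radialCutoff_eq_one_of_lt hR0 (lt_of_lt_of_le hx (min_le_left _ _)),
      radialCutoff_eq_one_of_lt hR0' (lt_of_lt_of_le hx (min_le_right _ _))]; ring
  have h := abs_integral_weight_mul_mul_le (hCf i) (hCf j) hM hzero
  have hI0 : 0 ≤ ∫ y : ZM, Real.exp (-‖y‖) := integral_nonneg fun y => (Real.exp_pos _).le
  have hC0 : 0 ≤ Cf := by
    have h := (abs_nonneg _).trans (hCf j 0)
    rwa [norm_zero, neg_zero, Real.exp_zero, mul_one] at h
  have hmin : Real.exp (-min R R') ≤ Real.exp (-R) + Real.exp (-R') := by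
    rcases le_total R R' with h | h
    · rw [min_eq_left h]; linarith [Real.exp_pos (-R')]
    · rw [min_eq_right h]; linarith [Real.exp_pos (-R)]
  calc |∫ x, (1 - radialCutoff R x * radialCutoff R' x) * (f i x * f j x)|
      ≤ 1 * Cf * Cf * Real.exp (-min R R') * ∫ y : ZM, Real.exp (-‖y‖) := h
    _ ≤ 1 * Cf * Cf * (Real.exp (-R) + Real.exp (-R')) * ∫ y : ZM, Real.exp (-‖y‖) := by gcongr
    _ = (Cf ^ 2 * ∫ y : ZM, Real.exp (-‖y‖)) * (Real.exp (-R) + Real.exp (-R')) := by ring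

end Flat

/-! ### §2. The bundled flat package from `IsEigenFamily` -/

section Package

variable {k : ℕ} {f : Fin (k + 1) → ZM → ℝ}

/-- **The flat quasimode package of an AL1 family, per level and at every radius, with ONE constant.**  For `IsEigenFamily k f` there are
`A ≥ 0` and a decay constant `C_f ≥ 0` (`|f_j| ≤ C_f e^{−‖x‖}`, and `C_f² ∫e^{−‖y‖} ≤ A`) such that for every `R ≥ 1` and every level `j`:
`𝔮(χ_R f_j) ≤ E_j ∫(χ_R f_j)² + A e^{−R}`, `1 − A e^{−R} ≤ ∫(χ_R f_j)² ≤ 1`, and for every `R′ ≥ 1` and `i ≠ j`,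
`|∫ χ_R f_i · χ_{R′} f_j| ≤ A (e^{−R} + e^{−R′})`. [cite: Agmon1982, (1.16″), Cor. 4.5] [cite: ReedSimonIV1978, Thm. XIII.64] -/
theorem flat_package (hf : IsEigenFamily k f) :
    ∃ A Cf : ℝ, 0 ≤ A ∧ 0 ≤ Cf ∧ (∀ j x, |f j x| ≤ Cf * Real.exp (-‖x‖)) ∧
      Cf ^ 2 * (∫ y : ZM, Real.exp (-‖y‖)) ≤ A ∧
      ∀ R : ℝ, 1 ≤ R → ∀ j : Fin (k + 1),
        energyForm (radialCutoff R * f j) ≤ physLevel ((j : ℕ) + 1) * (∫ y, (radialCutoff R * f j) y ^ 2) + A * Real.exp (-R) ∧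
        1 - A * Real.exp (-R) ≤ ∫ y, (radialCutoff R * f j) y ^ 2 ∧
        ∫ y, (radialCutoff R * f j) y ^ 2 ≤ 1 ∧
        ∀ R' : ℝ, 1 ≤ R' → ∀ i : Fin (k + 1), i ≠ j →
          |∫ y, (radialCutoff R * f i) y * (radialCutoff R' * f j) y| ≤ A * (Real.exp (-R) + Real.exp (-R')) := by
  obtain ⟨hsmooth, -, horth, heig, hdec⟩ := hf
  obtain ⟨Cf, hCf0, hCf⟩ := exists_uniform_decay hdec
  obtain ⟨M₁, hM0, hpack⟩ := radialCutoff_package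
  set I₉ : ℝ := ∫ y : ZM, Real.exp (-‖y‖) with hI₉
  have hI0 : 0 ≤ I₉ := integral_nonneg fun y => (Real.exp_pos _).le
  have hM₁ : ∀ R : ℝ, 1 ≤ R → (∀ x : ZM, ‖x‖ < R → radialCutoff R x = 1) ∧ ∀ x : ZM, ‖gradient (radialCutoff R) x‖ ^ 2 ≤ M₁ :=
    fun R hR => ⟨(hpack R hR).2.2.1, (hpack R hR).2.2.2.2⟩
  refine ⟨(M₁ / 2 + 1) * (Cf ^ 2 * I₉), Cf, by positivity, hCf0, hCf, ?_, fun R hR j => ⟨?_, ?_, ?_, fun R' hR' i hij => ?_⟩⟩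
  · have : 0 ≤ M₁ / 2 * (Cf ^ 2 * I₉) := by positivity
    linarith
  · have h := energyForm_cut_le hsmooth heig hCf hM₁ hR j
    have e : (1 / 2 : ℝ) * (M₁ * Cf ^ 2 * I₉) * Real.exp (-R) ≤ (M₁ / 2 + 1) * (Cf ^ 2 * I₉) * Real.exp (-R) := by
      have : 0 ≤ Cf ^ 2 * I₉ * Real.exp (-R) := by positivity
      nlinarith
    linarith
  · have h := (integral_cut_sq_bounds hsmooth horth hCf hR j).1
    have e : Cf ^ 2 * I₉ * Real.exp (-R) ≤ (M₁ / 2 + 1) * (Cf ^ 2 * I₉) * Real.exp (-R) := by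
      have : 0 ≤ Cf ^ 2 * I₉ * Real.exp (-R) := by positivity
      nlinarith
    linarith
  · exact (integral_cut_sq_bounds hsmooth horth hCf hR j).2
  · have h := abs_integral_cut_mul_cut_le hsmooth horth hCf hR hR' hij
    refine h.trans (mul_le_mul_of_nonneg_right ?_ (by positivity))
    have : 0 ≤ M₁ / 2 * (Cf ^ 2 * I₉) := by positivity
    linarith

end Package

end Summit.QuantumFields.YangMills.Theorems.FemtoTransferGap.TransplantForms

end
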